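/-
Copyright (c) 2026 the pub-hodgecm-mathlib formalisation cell (harness21).  Prover seat hodgecm-mathlib-K2E3-p12 (g2), Track B «K2-LIT» ∕ h413
(`stmt-HodgeConjecture-24833`), line `K2_E3_EllipticInputs`, unit U12-d «Harish-Chandra characters»: ON THE ONE-PLACE UNITARY MODEL `U(σ, J)(F) ≤ GL_N(F)` over a
local field, «`|D|^{1∕2} Θ` bounded near `1`» (the non-split input of ★ `K2E3NormalizedCharBddNearSemisimpleModelTransport`) FROM its Lie form on `𝔲(σ, J)` (★
`K2E3LieUnitaryDefs.lieOfForm`), and that form FROM the Lie-algebra core (L-A_U) + (L-B_U) — the twin of ★ `K2E3GLnNormalizedCharBddNearIdentityOfLieCore`.  2026-09-04.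
-/
import Summits.HodgeConjecture.HodgeConjecture.Theorems.K2E3LieUnitaryDefs                      -- ★ (K2-defs1, on this seat's SPEC): `lieOfForm σ J`, `mem_lieOfForm_iff'`, `conj_mem_lieOfForm`, `isClosed_lieOfForm`, `lieFourier`
import Summits.HodgeConjecture.HodgeConjecture.Theorems.K2E3CayleySliceCoversNhdsCentral         -- ★ (K2E1b-p15): `skew_of_form_preserving`, `cayley_invCayley`, `isUnit_one_sub∕add_invCayley`
import Summits.HodgeConjecture.HodgeConjecture.Theorems.K2E3CayleyCharpolyDiscr                  -- ★ p855189: `unit_mul_det_pow_eq_of_cayley`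
import Literature.NumberTheory.Automorphic.LocalRingUnitModulusProduct                           -- ★ `distribHaarChar_eq_normAbs`
import Literature.NumberTheory.Automorphic.LocalFieldHaarBalls                                   -- ★ `LocalFieldHaar.continuous_normAbs`
import Literature.NumberTheory.Rogawski1990.LocalTransferFundamentalLemma                        -- ★ `IsLocSmooth`
import Mathlib.Topology.Instances.Matrix
import HarnessLib

/-!
# K2_E3 road (h413 = stmt-HodgeConjecture-24833), unit U12-d on the model `U(σ, J)(F)` — «`|D|^{1∕2}·Θ` BOUNDED NEAR `1`» ⟸ ITS LIE FORM ⟸ (L-A_U) + (L-B_U)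

Cell `pub/hodgecm-mathlib` (D-0151), Track B (21-frontier RULING «PUSH BOTH» 2026-09-03, director req624), seat K2E3-p12 (g2), line lead of row 12 (12-S).
`--supports stmt-HodgeConjecture-24833 --as helper`; THEOREMS ONLY (no definition ∕ instance ∕ notation ∕ named fact ∕ `sorry`); never imports `Cruxes/…/Lines`.

★ p856031∕p856182 reduce socket U12-d at NON-SPLIT places to the statement (12-U) on the one-place unitary group `U(σ_w, H_w)(L_w)`: «`∃ U₀ ∋ 1` open, `∃ B`,
`√√‖u₀‖·|Θ₀ g| ≤ B` for `g ∈ U₀`, `u₀·det(g)^{N−1} = disc χ_g`».  This file, GENERIC over a non-archimedean local field `F` with `2 ≠ 0`, a continuous ring endomorphism `σ`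
and a form `J`, proves for `G₀ = U(σ, J)(F) = ↥(unitaryGroupOfForm σ J)` and its Lie algebra `𝔤 = ↥(lieOfForm σ J)` (★ `K2E3LieUnitaryDefs`, typed by K2-defs1 on this
seat's SPEC `SPEC-LieCore-U12.v1`):
* §1 **`uNormalizedCharBddNearOne_of_lieBound`** — (12-U) ⟸ (12-U-Lie) «`√√|disc χ_Y|_F·|Θ₀ g| ≤ B` for `g = c(Y)`, `Y` skew near `0`, `1 ± Y` units»: for `g ∈ U(σ,J)` near `1`
  the inverse Cayley transform `Y = (g−1)(g+1)⁻¹` is SKEW (★ `skew_of_form_preserving`) and `c(Y) = g` (★ `cayley_invCayley`); weights as in the `GL_N` twin with `√√`.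
* §2 **`uLieBound_of_lieCore`** — (12-U-Lie) ⟸ (L-A_U) «local expansion at `1` in `T̂`-form on `𝔲`» + (L-B_U) «Thm. 4.4 for `J(𝒩)` on `𝔲`», stated with ★ `lieFourier σ J ψ μ𝔤`,
  `Ad`-invariance through ★ `conj_mem_lieOfForm`, support off the nilpotent cone, and the weight `√√|disc χ_X|_F` [HC1999 Thm. 4.4 p. 11, §21 p. 87].
With ★ `K2E3GLnNormalizedCharBddNearIdentityOfLieCore` (split) the (12-Id) cone of `stub_charLocBdd` is now, at every place, a pair of Lie-algebra statements over the
local field.  [HarishChandra1999AdmissibleDistributions, Thm. 4.4 p. 11, Thm. 16.3 p. 77, §17, §21 p. 87] [PlatonovRapinchuk1994, §2.3, §3.3].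
HONEST LABEL: HC_CM is proved only modulo the 7 printed citations (2 remaining named inputs: hLiu418 = stmt-HodgeConjecture-24832, h413 =
stmt-HodgeConjecture-24833) until rung 0 closes; compositions only — (L-A_U), (L-B_U) are NOT proved here.

## References
* [HarishChandra1999AdmissibleDistributions] Harish-Chandra (DeBacker–Sally), *Admissible Invariant Distributions on Reductive p-adic Groups* (1999), Thm. 4.4, Thm. 16.3, §21.
* [PlatonovRapinchuk1994] V. Platonov, A. Rapinchuk, *Algebraic Groups and Number Theory* (1994), §2.3 (unitary groups), §3.3 (Cayley parametrisation).
-/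

set_option autoImplicit false
set_option linter.dupNamespace false   -- `Summit.HodgeConjecture.HodgeConjecture.…` (D-0017 nested layout; lakefile exemption for Summits)

noncomputable section

open MeasureTheory Filter Topology Polynomial
open scoped Matrix MatrixGroups NNReal
open Literature.NumberTheory.Rogawski1990 Literature.NumberTheory.Automorphic Literature.NumberTheory.Automorphic.UnitaryGroup
open Literature.NumberTheory.GaloisRepresentations Literature.NumberTheory.GaloisRepresentations.IsNonarchimedeanLocalField
open Summit.HodgeConjecture.HodgeConjecture.Cruxes.H413.K2E3CayleySliceCoversNhdsCentral
open Summit.HodgeConjecture.HodgeConjecture.Cruxes.H413.K2E3CayleyCharpolyDiscr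
open Summit.HodgeConjecture.HodgeConjecture.Cruxes.H413.K2E3LieUnitary

namespace Summit.HodgeConjecture.HodgeConjecture.Cruxes.H413.K2E3UNormalizedCharBddNearIdentityOfLieCore

variable {F : Type*} [Field F] [ValuativeRel F] [TopologicalSpace F] [IsNonarchimedeanLocalField F] {N : ℕ}
  (σ : F →+* F) (J : Matrix (Fin N) (Fin N) F)

/-! ## §1  (12-U) from its Lie form, through the (skew) inverse Cayley chart at `1` -/

set_option maxHeartbeats 800000 in
/-- **(12-U) ⟸ (12-U-Lie) on `U(σ, J)(F)`** (`2 ≠ 0`; `Θ₀ : U(σ,J)(F) → ℂ` arbitrary): if `√√|disc χ_Y|_F·|Θ₀ g| ≤ B` whenever `g = c(Y)` with `Y` SKEW (`(σY)ᵀJ = −JY`) near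
`0` and `1 ± Y` invertible, then `√√‖u₀‖_F·|Θ₀ g| ≤ B′` for `g` near `1` and every `u₀` with `u₀·det(g)^{N−1} = disc χ_g`: `Y = (g−1)(g+1)⁻¹` is skew for unitary `g`
(★ `skew_of_form_preserving`), `c(Y) = g` (★ `cayley_invCayley`), `‖u₀‖·|(det(1−Y)det(1+Y))^{N−1}| = |2|^{N(N−1)}|disc χ_Y|` (★ `unit_mul_det_pow_eq_of_cayley`).
[cite: HarishChandra1999AdmissibleDistributions, Thm. 16.3 p. 77, §17] [cite: PlatonovRapinchuk1994, §3.3] -/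
theorem uNormalizedCharBddNearOne_of_lieBound (h2 : (2 : F) ≠ 0) (Θ₀ : ↥(unitaryGroupOfForm σ J) → ℂ)
    (hLie : ∃ V : Set (Matrix (Fin N) (Fin N) F), V ∈ 𝓝 (0 : Matrix (Fin N) (Fin N) F) ∧ ∃ B : ℝ, ∀ g : ↥(unitaryGroupOfForm σ J), ∀ Y ∈ V,
      (Y.map σ)ᵀ * J = -(J * Y) → IsUnit (1 - Y) → IsUnit (1 + Y) → ((g : GL (Fin N) F) : Matrix (Fin N) (Fin N) F) = (1 + Y) * (1 - Y)⁻¹ →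
      ((NNReal.sqrt (NNReal.sqrt (normAbs F Y.charpoly.discr)) : ℝ≥0) : ℝ) * ‖Θ₀ g‖ ≤ B) :
    ∃ U₀ : Set ↥(unitaryGroupOfForm σ J), IsOpen U₀ ∧ (1 : ↥(unitaryGroupOfForm σ J)) ∈ U₀ ∧ ∃ B : ℝ, ∀ g ∈ U₀, ∀ u₀ : Fˣ,
      (u₀ : F) * ((((g : GL (Fin N) F)) : Matrix (Fin N) (Fin N) F).det) ^ (N - 1) = ((((g : GL (Fin N) F)) : Matrix (Fin N) (Fin N) F).charpoly).discr →
      ((NNReal.sqrt (NNReal.sqrt (unitModulusChar F u₀)) : ℝ≥0) : ℝ) * ‖Θ₀ g‖ ≤ B := by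
  obtain ⟨V, hV, B, hB⟩ := hLie
  have ht : (2 : F) * (2 : F)⁻¹ = 1 := mul_inv_cancel₀ h2
  haveI : T2Space F := (Literature.NumberTheory.GaloisRepresentations.IsNonarchimedeanLocalField.isLocalField F).toT2Space
  -- the unit factor and its lower bound near `0`
  set Mf : Matrix (Fin N) (Fin N) F → ℝ≥0 := fun Y => normAbs F (((1 - Y).det * (1 + Y).det) ^ (N - 1)) with hMf
  have hMc : Continuous Mf := by
    have h1 : Continuous fun Y : Matrix (Fin N) (Fin N) F => (1 - Y).det := continuous_id.matrix_det.comp (continuous_const.sub continuous_id)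
    have h2' : Continuous fun Y : Matrix (Fin N) (Fin N) F => (1 + Y).det := continuous_id.matrix_det.comp (continuous_const.add continuous_id)
    exact LocalFieldHaar.continuous_normAbs.comp ((h1.mul h2').pow _)
  have hM0 : Mf 0 = 1 := by simp only [hMf, sub_zero, add_zero, Matrix.det_one, mul_one, one_pow, map_one]
  have hVM : Mf ⁻¹' Set.Ioi (1 / 2) ∈ 𝓝 (0 : Matrix (Fin N) (Fin N) F) := by
    refine (hMc.isOpen_preimage _ isOpen_Ioi).mem_nhds ?_
    rw [Set.mem_preimage, hM0, Set.mem_Ioi]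
    exact one_half_lt_one
  -- the inverse Cayley chart near `1`
  set ic : Matrix (Fin N) (Fin N) F → Matrix (Fin N) (Fin N) F := fun M => (M - 1) * (M + 1)⁻¹ with hic
  have hic0 : ic 1 = 0 := by simp only [hic, sub_self, zero_mul]
  have hdet2 : ((1 : Matrix (Fin N) (Fin N) F) + 1).det ≠ 0 := by
    rw [show ((1 : Matrix (Fin N) (Fin N) F) + 1) = (2 : F) • (1 : Matrix (Fin N) (Fin N) F) by rw [two_smul], Matrix.det_smul, Matrix.det_one, mul_one]
    exact pow_ne_zero _ h2
  have hicc0 : ContinuousAt ic 1 := by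
    have hinv : ContinuousAt (fun M : Matrix (Fin N) (Fin N) F => (M + 1)⁻¹) 1 := by
      have h1 : ContinuousAt Inv.inv ((1 : Matrix (Fin N) (Fin N) F) + 1) := by
        refine continuousAt_matrix_inv _ ?_
        rw [Ring.inverse_eq_inv']
        exact continuousAt_inv₀ hdet2
      exact ContinuousAt.comp (g := Inv.inv) h1 (continuousAt_id.add continuousAt_const)
    exact (continuousAt_id.sub continuousAt_const).mul hinv
  set val : ↥(unitaryGroupOfForm σ J) → Matrix (Fin N) (Fin N) F := fun g => ((g : GL (Fin N) F) : Matrix (Fin N) (Fin N) F) with hval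
  have hvalc : Continuous val := Units.continuous_val.comp continuous_subtype_val
  have hval1 : val 1 = 1 := rfl
  have hicc : ContinuousAt (fun g : ↥(unitaryGroupOfForm σ J) => ic (val g)) 1 := by
    have h := hicc0
    rw [← hval1] at h
    exact h.comp hvalc.continuousAt
  set W : Set ↥(unitaryGroupOfForm σ J) := {g | IsUnit (val g + 1).det} ∩ (fun g => ic (val g)) ⁻¹' (V ∩ Mf ⁻¹' Set.Ioi (1 / 2)) with hW
  have hW1 : W ∈ 𝓝 (1 : ↥(unitaryGroupOfForm σ J)) := by
    refine Filter.inter_mem ?_ (hicc.preimage_mem_nhds (by rw [hval1, hic0]; exact Filter.inter_mem hV hVM))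
    have hopen : IsOpen {g : ↥(unitaryGroupOfForm σ J) | IsUnit (val g + 1).det} := by
      have hc : Continuous fun g : ↥(unitaryGroupOfForm σ J) => (val g + 1).det := (hvalc.add continuous_const).matrix_det
      simp_rw [isUnit_iff_ne_zero]
      exact isOpen_ne_fun hc continuous_const
    refine hopen.mem_nhds ?_
    change IsUnit (val 1 + 1).det
    rw [hval1]
    exact isUnit_iff_ne_zero.2 hdet2
  set K : ℝ≥0 := normAbs F ((2 : F) ^ (N * (N - 1))) with hK
  refine ⟨interior W, isOpen_interior, mem_interior_iff_mem_nhds.2 hW1, ((NNReal.sqrt (NNReal.sqrt (2 * K)) : ℝ≥0) : ℝ) * max B 0, fun g hg u₀ hu => ?_⟩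
  obtain ⟨hP, hYV, hYM⟩ := interior_subset hg
  set Y : Matrix (Fin N) (Fin N) F := ic (val g) with hYdef
  have hmem : ((val g).map σ)ᵀ * J * val g = J := mem_unitaryGroupOfForm_iff.1 g.2
  have hskew : (Y.map σ)ᵀ * J = -(J * Y) := skew_of_form_preserving σ hmem hP
  have hY1 : IsUnit (1 - Y) := isUnit_one_sub_invCayley _ hP ht
  have hY2 : IsUnit (1 + Y) := isUnit_one_add_invCayley _ (Matrix.isUnits_det_units (g : GL (Fin N) F)) hP ht
  have hgY : val g = (1 + Y) * (1 - Y)⁻¹ := (cayley_invCayley _ hP ht).symm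
  have hLie := hB g Y hYV hskew hY1 hY2 hgY
  -- the weight comparison
  have hu' : (u₀ : F) * (((1 + Y) * (1 - Y)⁻¹).det) ^ (N - 1) = ((1 + Y) * (1 - Y)⁻¹).charpoly.discr := by
    have h := hu
    change (u₀ : F) * (val g).det ^ (N - 1) = (val g).charpoly.discr at h
    rwa [hgY] at h
  have hid := unit_mul_det_pow_eq_of_cayley Y ((Matrix.isUnit_iff_isUnit_det _).1 hY1) (u₀ : F) hu'
  have hmod : unitModulusChar F u₀ * Mf Y = K * normAbs F Y.charpoly.discr := by
    rw [unitModulusChar, distribHaarChar_eq_normAbs, hMf, hK, ← map_mul, ← map_mul, hid]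
  set D : ℝ≥0 := normAbs F Y.charpoly.discr with hD
  have hle : unitModulusChar F u₀ ≤ 2 * K * D := by
    have h2' : unitModulusChar F u₀ * (1 / 2) ≤ unitModulusChar F u₀ * Mf Y := mul_le_mul_of_nonneg_left hYM.le (zero_le)
    rw [hmod] at h2'
    calc unitModulusChar F u₀ = unitModulusChar F u₀ * (1 / 2) * 2 := by rw [mul_assoc, one_div, inv_mul_cancel₀ (two_ne_zero), mul_one]
      _ ≤ K * D * 2 := mul_le_mul_of_nonneg_right h2' (zero_le)
      _ = 2 * K * D := by ring
  have hsqrt : NNReal.sqrt (NNReal.sqrt (unitModulusChar F u₀)) ≤ NNReal.sqrt (NNReal.sqrt (2 * K)) * NNReal.sqrt (NNReal.sqrt D) := by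
    rw [← NNReal.sqrt_mul, ← NNReal.sqrt_mul]
    exact NNReal.sqrt_le_sqrt.2 (NNReal.sqrt_le_sqrt.2 hle)
  have hB0 : B ≤ max B 0 := le_max_left _ _
  calc ((NNReal.sqrt (NNReal.sqrt (unitModulusChar F u₀)) : ℝ≥0) : ℝ) * ‖Θ₀ g‖
      ≤ (((NNReal.sqrt (NNReal.sqrt (2 * K)) * NNReal.sqrt (NNReal.sqrt D) : ℝ≥0)) : ℝ) * ‖Θ₀ g‖ :=
        mul_le_mul_of_nonneg_right (NNReal.coe_le_coe.2 hsqrt) (norm_nonneg _)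
    _ = ((NNReal.sqrt (NNReal.sqrt (2 * K)) : ℝ≥0) : ℝ) * ((((NNReal.sqrt (NNReal.sqrt D)) : ℝ≥0) : ℝ) * ‖Θ₀ g‖) := by rw [NNReal.coe_mul, mul_assoc]
    _ ≤ ((NNReal.sqrt (NNReal.sqrt (2 * K)) : ℝ≥0) : ℝ) * max B 0 := mul_le_mul_of_nonneg_left (hLie.trans hB0) (NNReal.coe_nonneg _)

/-! ## §2  The Lie form from the Lie-algebra core (L-A_U) + (L-B_U) on `𝔲(σ, J)` -/

set_option maxHeartbeats 800000 in
/-- **(12-U-Lie) ⟸ (L-A_U) + (L-B_U).**  Frame: `𝔤 = ↥(lieOfForm σ J)` with an additive Haar measure `μ𝔤`, a character `ψ : F → ℂ`, the Fourier transform ★ `lieFourier σ J ψ μ𝔤`;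
`J(𝒩)` = the `Ad(U(σ,J))`-invariant (★ `conj_mem_lieOfForm`) linear functionals on `C_c^∞(𝔤)` vanishing on test functions supported off the nilpotent elements.  `hA` = (L-A_U):
`∃ V ∋ 0`, `∃ T ∈ J(𝒩)`, `Θ₀(c(Y)) = F_T(Y)` for regular `Y ∈ 𝔤` with `Y ∈ V` and `1 ± Y` units, for every `F_T` representing `T̂` locally constant at the regular points;
`hB` = (L-B_U): every `T ∈ J(𝒩)` has such an `F_T`, locally integrable, with `√√|disc χ_X|_F·|F_T X|` bounded on compacta.  [cite: HarishChandra1999AdmissibleDistributions,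
Thm. 4.4 p. 11, §21 p. 87] [cite: PlatonovRapinchuk1994, §2.3] -/
theorem uLieBound_of_lieCore (hσ : Continuous σ) [MeasurableSpace ↥(lieOfForm σ J)] [BorelSpace ↥(lieOfForm σ J)]
    (μ𝔤 : Measure ↥(lieOfForm σ J)) [μ𝔤.IsAddHaarMeasure] (ψ : F → ℂ) (Θ₀ : ↥(unitaryGroupOfForm σ J) → ℂ)
    (hA : ∃ V : Set (Matrix (Fin N) (Fin N) F), V ∈ 𝓝 (0 : Matrix (Fin N) (Fin N) F) ∧
      ∃ T : (↥(lieOfForm σ J) → ℂ) → ℂ,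
        ((∀ f₁ f₂ : ↥(lieOfForm σ J) → ℂ, IsLocSmooth f₁ → IsLocSmooth f₂ → T (f₁ + f₂) = T f₁ + T f₂) ∧
         (∀ (a : ℂ) (f : ↥(lieOfForm σ J) → ℂ), IsLocSmooth f → T (a • f) = a * T f) ∧
         (∀ (x : ↥(unitaryGroupOfForm σ J)) (f : ↥(lieOfForm σ J) → ℂ), IsLocSmooth f →
            T (fun X => f ⟨((x : GL (Fin N) F) : Matrix (Fin N) (Fin N) F) * X.1 * (((x : GL (Fin N) F)⁻¹ : GL (Fin N) F) : Matrix (Fin N) (Fin N) F),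
              conj_mem_lieOfForm x.2 X.2⟩) = T f) ∧
         (∀ f : ↥(lieOfForm σ J) → ℂ, IsLocSmooth f → (∀ X ∈ tsupport f, ¬ IsNilpotent X.1) → T f = 0)) ∧
        ∀ Fn : ↥(lieOfForm σ J) → ℂ,
          (∀ f : ↥(lieOfForm σ J) → ℂ, IsLocSmooth f → T (lieFourier σ J ψ μ𝔤 f) = ∫ X, f X * Fn X ∂μ𝔤) →
          (∀ X : ↥(lieOfForm σ J), IsUnit X.1.charpoly.discr → ∀ᶠ Y in 𝓝 X, Fn Y = Fn X) →
          ∀ g : ↥(unitaryGroupOfForm σ J), ∀ Y : ↥(lieOfForm σ J), Y.1 ∈ V → IsUnit Y.1.charpoly.discr → IsUnit (1 - Y.1) → IsUnit (1 + Y.1) →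
            ((g : GL (Fin N) F) : Matrix (Fin N) (Fin N) F) = (1 + Y.1) * (1 - Y.1)⁻¹ → Θ₀ g = Fn Y)
    (hB : ∀ T : (↥(lieOfForm σ J) → ℂ) → ℂ,
        ((∀ f₁ f₂ : ↥(lieOfForm σ J) → ℂ, IsLocSmooth f₁ → IsLocSmooth f₂ → T (f₁ + f₂) = T f₁ + T f₂) ∧
         (∀ (a : ℂ) (f : ↥(lieOfForm σ J) → ℂ), IsLocSmooth f → T (a • f) = a * T f) ∧
         (∀ (x : ↥(unitaryGroupOfForm σ J)) (f : ↥(lieOfForm σ J) → ℂ), IsLocSmooth f →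
            T (fun X => f ⟨((x : GL (Fin N) F) : Matrix (Fin N) (Fin N) F) * X.1 * (((x : GL (Fin N) F)⁻¹ : GL (Fin N) F) : Matrix (Fin N) (Fin N) F),
              conj_mem_lieOfForm x.2 X.2⟩) = T f) ∧
         (∀ f : ↥(lieOfForm σ J) → ℂ, IsLocSmooth f → (∀ X ∈ tsupport f, ¬ IsNilpotent X.1) → T f = 0)) →
        ∃ Fn : ↥(lieOfForm σ J) → ℂ, LocallyIntegrable Fn μ𝔤 ∧
          (∀ f : ↥(lieOfForm σ J) → ℂ, IsLocSmooth f → T (lieFourier σ J ψ μ𝔤 f) = ∫ X, f X * Fn X ∂μ𝔤) ∧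
          (∀ X : ↥(lieOfForm σ J), IsUnit X.1.charpoly.discr → ∀ᶠ Y in 𝓝 X, Fn Y = Fn X) ∧
          (∀ C : Set ↥(lieOfForm σ J), IsCompact C → ∃ B : ℝ, ∀ X ∈ C,
              ((NNReal.sqrt (NNReal.sqrt (normAbs F X.1.charpoly.discr)) : ℝ≥0) : ℝ) * ‖Fn X‖ ≤ B)) :
    ∃ V : Set (Matrix (Fin N) (Fin N) F), V ∈ 𝓝 (0 : Matrix (Fin N) (Fin N) F) ∧ ∃ B : ℝ, ∀ g : ↥(unitaryGroupOfForm σ J), ∀ Y ∈ V,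
      (Y.map σ)ᵀ * J = -(J * Y) → IsUnit (1 - Y) → IsUnit (1 + Y) → ((g : GL (Fin N) F) : Matrix (Fin N) (Fin N) F) = (1 + Y) * (1 - Y)⁻¹ →
      ((NNReal.sqrt (NNReal.sqrt (normAbs F Y.charpoly.discr)) : ℝ≥0) : ℝ) * ‖Θ₀ g‖ ≤ B := by
  haveI : T2Space F := (Literature.NumberTheory.GaloisRepresentations.IsNonarchimedeanLocalField.isLocalField F).toT2Space
  obtain ⟨V, hV, T, hT, hTA⟩ := hA
  obtain ⟨Fn, -, hrepF, hlocF, hbd⟩ := hB T hT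
  -- a compact neighbourhood of `0` in `𝔤` and an ambient neighbourhood inside it
  haveI : LocallyCompactSpace (Matrix (Fin N) (Fin N) F) := inferInstanceAs (LocallyCompactSpace (Fin N → Fin N → F))
  haveI : LocallyCompactSpace ↥(lieOfForm σ J) := (Topology.IsClosedEmbedding.subtypeVal (isClosed_lieOfForm (σ := σ) (J := J) hσ)).locallyCompactSpace
  obtain ⟨C, hCc, hC0⟩ := exists_compact_mem_nhds (0 : ↥(lieOfForm σ J))
  obtain ⟨B, hBC⟩ := hbd C hCc
  have hC0' : C ∈ Filter.comap (Subtype.val : ↥(lieOfForm σ J) → Matrix (Fin N) (Fin N) F) (𝓝 0) := by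
    rw [← nhds_subtype_eq_comap]
    exact hC0
  obtain ⟨W, hW, hWC⟩ := Filter.mem_comap.1 hC0'
  refine ⟨V ∩ W, Filter.inter_mem hV hW, max B 0, fun g Y hY hskew h1 h2 hg => ?_⟩
  set Y' : ↥(lieOfForm σ J) := ⟨Y, (mem_lieOfForm_iff' Y).2 hskew⟩ with hY'
  have hY'C : Y' ∈ C := hWC (show Y'.1 ∈ W from hY.2)
  by_cases hreg : IsUnit Y.charpoly.discr
  · have hΘ : Θ₀ g = Fn Y' := hTA Fn hrepF hlocF g Y' hY.1 hreg h1 h2 hg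
    rw [hΘ]
    exact (hBC Y' hY'C).trans (le_max_left _ _)
  · have h0 : Y.charpoly.discr = 0 := by rwa [isUnit_iff_ne_zero, not_not] at hreg
    rw [h0, map_zero, NNReal.sqrt_zero, NNReal.sqrt_zero, NNReal.coe_zero, zero_mul]
    exact le_max_right _ _

end Summit.HodgeConjecture.HodgeConjecture.Cruxes.H413.K2E3UNormalizedCharBddNearIdentityOfLieCore

end
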